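import Literature.MathematicalPhysics.QuantumFieldTheory.Balaban1983to89.TreeLengthTorusGeometry236
import Summits.QuantumFields.BalabanUV.T4Continuum.Spine.NE1p.DressedSmallFieldGeometryFaces
import Summits.QuantumFields.BalabanUV.T4Continuum.Spine.NE1p.DressedSmallFieldComponentCount

/-!
# T⁴ programme, spine estimate NE1′ (node O3b/H2) — THE L-REFINEMENT BETWEEN THE TWO TORI IS IN THE TREE: the owner's N0w END
# `attachedPart_locE_le_of_coresAt_pencil_components` ON pv22's NESTED TORI `tsys 4 (L·N′)` (scale k) ⊂ `tsys 4 N′` (scale k+1, the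
# SAME torus blocked by `L`), with the closure `cl := tclosureDom L N′` (print's Z ↦ Z′), the (2.36)-KIND transfer DISCHARGED BY NAME
# by pv22's `ineq236With_torus` (ℓ = L∕a236 L) and the ANCHOR CONSTRUCTED (`#anc ≤ 3⁴·L⁴` from the fibres of the block map) —
# three of N0w's four geometric READING binders GONE; [Balaban1988RGII] p. 19–20 KIND

Cell `pub-balaban`, sub-cell `t4`, BINDER-OWNERS row NE1′ (owner lineage t4-ne1p-p1, road P1 «RG-trajectory comparison … μ-uniformity
through the printed small-field bounds»); crew seat `b2b-balaban-t4-ne1p-formalise-leaf-01` (LEAF PROVER 01, generation 13); crew S-row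
S44 ∕ DAG N29zzv (INTENT `CLAIMS.log` 2026-08-20 l.19927, PROTOTYPE l.19985, re-titled l.20019; BOOKED-AHEAD typer R-T127 l.20102; X169 its
read; disjoint from crew row S43 = the REFINEMENT direction `Support/TorusBlockRefinement`).  ADDITIVE — imports the owner's N0w
`Spine/NE1p/DressedSmallFieldComponentCount` (→ N0v → N0u → N0t → N0s → …), crew row S24 `Spine/NE1p/DressedSmallFieldGeometryFaces` (for
`K₀_four`; → N0o `torus_consts`) and pv22 gen 3's [cite]-tagged `Literature/…/Balaban1983to89/TreeLengthTorusGeometry236` (→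
`TreeLengthTorusTransfer` → `TreeLengthTorusGeometry` → `TreeLengthTorus`: the periodic index model `TPt`, `proj`, `natLift`, the block map
`tcoarse`, □̃∕X̃ on the torus `tblock`∕`tcollar`, Z ↦ Z′ `tclosure`∕`tclosureDom`, `exists_lift_of_mem_tclosure`, `card_tblock_le`,
`ineq236With_torus`) ONLY; THEOREMS ONLY (0 `def`, 0 `def … : Prop`, 0 cite); nothing of N0s–N0w ∕ S24 ∕ N0o ∕ b13 ∕ pv22 is restated —
their declarations are used BY NAME.

WHY THIS FILE.  Every two-scale crew face so far (S34, S39, the torus ENDs of leaf-07's link rows) and the typer's riders read «`foot`∕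
`hmono`∕`cl`∕`anc`∕`htransfer` DISPLAYED — the L-refinement between the two tori is NOT constructed here».  It IS constructed, in the
tree, by pv22 gen 3: `TreeLengthTorusTransfer` types the papers' situation ([Balaban1987RG1] p. 251: ONE torus; π_{k+1}-cubes = blocks of
L^d cubes of π_k) as the fine torus `tsys d (L·N′)` with the block map `tcoarse L N′ : TPt d (L·N′) → TPt d N′` onto the coarse torus
`tsys d N′`, the closure `tclosureDom L N′ : TDom d (L·N′) → TDom d N′` (print p. 19 «we denote by Z′_i the smallest localization domain
from 𝐃_{k+1} containing Z̃_i»), and `TreeLengthTorusGeometry236.ineq236With_torus (hL : 3 ≤ L) : B13.Ineq236With (tsys d (L·N′))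
(tsys d N′) (tclosureDom L N′) (L ∕ a236 L)` — LITERALLY the shape of N0w's `htransfer` («∀ Z₀, ℓ·d(cl Z₀) ≤ d_k(Z₀)») with the cell's
certified factor ℓ = L∕a236 L (print's ½L is unproved in print — GAPS G-B13-09∕09R; TYPE∕CONTEXT here).  No `Spine/NE1p` module
imported it.  This file fires N0w's END there:
* §1 [folklore, ℤ-arithmetic]: `coarse_mem_block_of_mem_block` — the block map is 1-Lipschitz for □̃ (`y ∈ □̃(x) ⇒ coarse L x ∈
  □̃(coarse L y)`); `proj_mem_tblock` — □̃ on the torus through ANY lift; `tcoarse_mem_tblock` — an anchor candidate coarsens into the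
  □̃ of the anchor cell.
* §2 [folklore]: `natLift_mem_box_of_tcoarse_eq` (same class on the coarse torus + both standard lifts in `[0, N′)` ⇒ equal block
  index ⇒ the fine cube's standard lift lies in the window block `Π [L·b̃ᵢ, L·b̃ᵢ + L)`) and **`card_filter_tcoarse_le`: every block of
  the coarse torus contains at most `L^d` cubes of the fine torus** (`Fintype.piFinset`, `card_le_card_of_injOn natLift`).
* §3 THE ANCHOR [folklore]: for a cell `b` of the coarse torus the anchor set is `{a | ∃ y ∈ □̃(natLift a), proj (coarse L y) = b}` —
  print p. 19–20 «an additional sum over (L+2)⁴ cubes □′ from π_k, the cubes touching a fixed LM-cube in Z′_i» on the cell's format;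
  `exists_mem_anchor`: every fine domain `Z₀` whose closure contains `b` has a cube in the anchor set of `b` (pv22's
  `exists_lift_of_mem_tclosure` BY NAME); **`card_anchor_le`: the anchor set has at most `3^d·L^d` elements** (§1 + pv22's
  `card_tblock_le` + §2; print's `(L+2)⁴` is TYPE∕CONTEXT — `3⁴L⁴` is OUR bound).
* §4 END **`attachedPart_locE_le_of_coresAt_pencil_components_nestedTori`** — N0w's END ONCE BY NAME at `D := tsys 4 N′`,
  `G := tgeometry 4 N′`, `Dk := tsys 4 (L·N′)`, `Gk := tgeometry 4 (L·N′)`, with `cl := tclosureDom L N′`, `htransfer :=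
  ineq236With_torus` (under `3 ≤ L`), `anc`∕`hanchor`∕`hA` := §3 at a displayed cell selector `bsel Z′ ∈ Z′` (`Aₐ := 3⁴·L⁴`), and the
  (2.29)∕step clauses AS LOCATED NUMERALS AT BOTH SCALES by N0o `torus_consts` (read at `N′` AND at `L·N′` — the same numerals, N′-
  and L-uniform) + S24 `K₀_four`; conclusion LITERALLY the crew torus currency at the COARSE torus
  `4·(e·9·64·K₀(64,8)²)·A₁·e^{−r₁·torusTreeLen X₀}` (the selector `bsel` is ANY choice of one cell per member, e.g. `Z′.2.1.choose`).

PRINTED LOCI (TYPE ∕ CONTEXT only — [Balaban1988RGII] = CMP 116 (1988) pp. 13, 19–20 and [Balaban1987RG1] = CMP 109 (1987) pp. 251,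
257, read as images this generation on `b2b-balaban-ref1/pages/1988-cmp116-rg-II-cluster/…-p019∕p020-x2.png` and quoted VERBATIM in the
imported pv22 modules' citation headers; nothing below is used as a fact about Bałaban's densities): p. 19 «For each Z′_i we sum over all
possible components of Z₀ determining this Z′_i … 2d_k(Z_i) ≥ Ld_{k+1}(Z′_i). (2.36) … The last sum is estimated using (1.28), with κ
replaced by δκ, and with an additional sum over (L+2)⁴ cubes □′ from π_k, the cubes» p. 20 «touching a fixed LM-cube in Z′_i».
WHAT STAYS DISPLAYED (binders, by name; NOTHING instantiated on Bałaban's densities): the room, operator conditions, class radii;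
(B1b)'s residue `terms`∕`emb`∕`hscale`∕`hact` and `hadm` (inner data = components `Z₀` of the FINE torus with `tclosureDom L N′ Z₀ = Z′`
and a label in `I Z₀` — (B1b)∕(2.35) READING); the cell selector `bsel`∕`hbsel` (ANY choice of one cell per member; removable);
N0u's inner-count SHAPE `hinner` at the fine torus's `torusTreeLen` (crew S41 PART 2 supplies it from N0u); N0v's (2.27)∘(2.37)-KIND
link `hlink` at the coarse torus (crew S40 PART 2 supplies it at `5`); (B3-amp) `hAmp` — THE place where the dressed table radius
enters, p. 18's clause KIND at `C₃(E₀ + D₀)`, NOT asserted; the located clauses «κ large» `64·log 162 + 1 ≤ r`, `r₁ + 2·(64·log 162) +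
2 ≤ Rkp`, `64·log 162 ≤ R₀`, «α₆∕ε₁ small» `e·K₀(64,8)·64·(ε·e^{c₀}·3⁴L⁴·K₀(64,8)·e^{5R}) ≤ 1`, `(A₀+ϱA₁)·e^{5r₁+1}·K₀(64,8)·9·64
≤ 1`, the transfer's rate `r + R ≤ (R₀ − 64·log 162)·(L∕a236 L)`, `Rkp ≤ R − 64·v·e^{Rc′}` and `3 ≤ L` — (B5)-KIND bookkeeping on
displayed letters whose standing against print's δ, κ, κ₁, α₆, L, M is NOT asserted.  WHAT IT SAYS FOR THE WALL (the owner's reading,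
Q47 RULED T4-DAG v45 §8; nothing re-labelled here): of the (B3-count) items displayed «of printed KIND» after N0w — the links, the
(2.36) transfer, the anchor — the TRANSFER and the ANCHOR are KERNEL on pv22's CONSTRUCTED nested tori (pv22's [cite]-tagged substitute
for the unproved printed (2.36), G-B13-09R); the identification of `tsys`∕`torusTreeLen`∕`tclosureDom` with Bałaban's 𝐃_k ⊂ 𝐃_{k+1} ∕
d_k ∕ Z′ is pv22's READING (D-pv22.3 ∕ D-pv22g2.1 ∕ D-pv22g3.1), asserted nowhere.  NOTHING of (B3) discharged on Bałaban's (2.14)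
densities; 0 binders instantiated on Bałaban's densities; no wall item moves; wall v1.7 (T4-DAG v46) does NOT move; R-t4r2-Q2 NOT met
thereby; NE1′ ⇐ the named binders — NOT printed, NOT proved; spine PROVED 0∕9; count 9 unchanged.
HONEST FRAMING.  Finite ℤ∕N combinatorics ([folklore]) + by-name applications of pv22's torus theorems and N0w's END; the cores ∕
labels are the cell's typed FORMAT of (2.14) and of the resummation index, NOT Bałaban's functions; the located numerals are pv22's
PROVED constants; N0s∕N0u's `foot`∕`hmono` (coarse polymer ↦ its fine refinement) are NOT in this file; ABSOLUTE RULE honoured —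
nothing internally minted is cited, [folklore] tags on kernel lemmas only.  Rung (B)+1 on ONE finite four-torus — NOT infinite volume,
NOT a mass gap, NOT OS on ℝ⁴, NOT Clay.  HONEST DEPENDENCY: continuum YM on T⁴ ⇐ BetaPertH ∧ nine spine estimates (0/9 proved); BetaPertH
⇐ (D1) ∧ (D4) ∧ CAP+tail; G-an2-4 gates asym, D1 and NE2/3/4.
-/

noncomputable section

namespace Summit.QuantumFields.BalabanUV.T4Continuum.NE1p.DressedSmallFieldNestedTori

open Literature.MathematicalPhysics.QuantumFieldTheory.Balaban1983to89
open Literature.MathematicalPhysics.QuantumFieldTheory.Balaban1983to89.B13ScaleTransfer (Pt block mem_block card_block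
  coarse)
open Literature.MathematicalPhysics.QuantumFieldTheory.Balaban1983to89.TreeLengthTorus (TPt proj natLift proj_natLift tsys
  TDom torusTreeLen)
open Literature.MathematicalPhysics.QuantumFieldTheory.Balaban1983to89.TreeLengthTorusGeometry (period proj_add_period
  exists_period_of_proj_eq tgeometry)
open Literature.MathematicalPhysics.QuantumFieldTheory.Balaban1983to89.TreeLengthTorusTransfer (tcoarse tcoarse_proj tblock
  tcollar tclosure tclosureDom card_tblock_le)
open Literature.MathematicalPhysics.QuantumFieldTheory.Balaban1983to89.TreeLengthTorusGeometry236 (exists_lift_of_mem_tclosure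
  ineq236With_torus)

variable {d : ℕ}

/-! ## §1 The block map and the 3^d-blocks -/

/-- The block map is 1-Lipschitz for the block (□̃) neighbourhoods: if `y ∈ □̃(x)` then `coarse L x ∈ □̃(coarse L y)`
(coordinatewise `|xᵢ − yᵢ| ≤ 1 ⇒ |⌊xᵢ∕L⌋ − ⌊yᵢ∕L⌋| ≤ 1`). [folklore] -/
theorem coarse_mem_block_of_mem_block {L : ℕ} (hL : 0 < L) {x y : Pt d} (hy : y ∈ block x) :
    coarse L x ∈ block (coarse L y) := by
  rw [mem_block] at hy ⊢
  intro i
  obtain ⟨h1, h2⟩ := hy i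
  have hL' : (0 : ℤ) < L := by exact_mod_cast hL
  have hL1 : (1 : ℤ) ≤ L := by exact_mod_cast hL
  have hne : (L : ℤ) ≠ 0 := hL'.ne'
  show y i / (L : ℤ) - 1 ≤ x i / (L : ℤ) ∧ x i / (L : ℤ) ≤ y i / (L : ℤ) + 1
  constructor
  · have h : y i + (-1) * (L : ℤ) ≤ x i := by linarith
    have := Int.ediv_le_ediv hL' h
    rwa [Int.add_mul_ediv_right _ _ hne] at this
  · have h : x i ≤ y i + 1 * (L : ℤ) := by linarith
    have := Int.ediv_le_ediv hL' h
    rwa [Int.add_mul_ediv_right _ _ hne] at this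

/-- □̃ on the torus through ANY lift: `y ∈ □̃(x)` in the cover ⇒ `proj y ∈ tblock (proj x)` on the torus. [folklore] -/
theorem proj_mem_tblock {N : ℕ} [NeZero N] {x y : Pt d} (hy : y ∈ block x) : proj N y ∈ tblock (proj N x) := by
  obtain ⟨k, hk⟩ := exists_period_of_proj_eq (proj_natLift (proj N x)).symm
  unfold tblock
  rw [Finset.mem_image]
  refine ⟨y + period N k, ?_, proj_add_period y k⟩
  rw [hk, mem_block]
  rw [mem_block] at hy
  intro i
  obtain ⟨h1, h2⟩ := hy i
  simp only [Pi.add_apply]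
  exact ⟨by linarith, by linarith⟩

/-- An anchor candidate coarsens into the 3^d-block of the anchor cell: `y ∈ □̃(natLift a)` and `proj (coarse L y) = b`
⇒ `tcoarse a ∈ tblock b`. [folklore] -/
theorem tcoarse_mem_tblock {L N' : ℕ} [NeZero L] [NeZero N'] {a : TPt d (L * N')} {y : Pt d}
    (hy : y ∈ block (natLift a)) {b : TPt d N'} (hb : proj N' (coarse L y) = b) : tcoarse L N' a ∈ tblock b := by
  rw [← hb]
  exact proj_mem_tblock (coarse_mem_block_of_mem_block (Nat.pos_of_ne_zero (NeZero.ne L)) hy)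

/-! ## §2 The fibres of the block map: at most `L^d` cubes per block -/

/-- A cube of the fine torus lying in the block `b` of the coarse torus has its standard lift in the window block
`[L·b̃ᵢ, L·b̃ᵢ + L)` of the standard lift `b̃` of `b`. [folklore] -/
theorem natLift_mem_box_of_tcoarse_eq {L N' : ℕ} [NeZero L] [NeZero N'] {a : TPt d (L * N')} {b : TPt d N'}
    (h : tcoarse L N' a = b) :
    natLift a ∈ Fintype.piFinset fun i => Finset.Ico ((L : ℤ) * natLift b i) ((L : ℤ) * natLift b i + L) := by
  have hL : 0 < L := Nat.pos_of_ne_zero (NeZero.ne L)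
  have hL' : (0 : ℤ) < L := by exact_mod_cast hL
  have hN : 0 < N' := Nat.pos_of_ne_zero (NeZero.ne N')
  -- the block index of the standard lift lies in [0, N′) coordinatewise, as does the standard lift of `b`
  have hc : ∀ i, 0 ≤ coarse L (natLift a) i ∧ coarse L (natLift a) i < N' := by
    intro i
    have h0 : (0 : ℤ) ≤ natLift a i := Int.natCast_nonneg _
    have h1 : natLift a i < (L : ℤ) * N' := by
      have := ZMod.val_lt (a i)
      have h' : ((a i).val : ℤ) < ((L * N' : ℕ) : ℤ) := by exact_mod_cast this
      rw [Nat.cast_mul] at h'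
      exact h'
    refine ⟨Int.ediv_nonneg h0 hL'.le, ?_⟩
    exact (Int.ediv_lt_iff_lt_mul hL').2 (by linarith [mul_comm (L : ℤ) (N' : ℤ)])
  have hb : ∀ i, 0 ≤ natLift b i ∧ natLift b i < N' := fun i =>
    ⟨Int.natCast_nonneg _, by
      have := ZMod.val_lt (b i)
      show ((b i).val : ℤ) < N'
      exact_mod_cast this⟩
  -- same class + both in range ⇒ equal
  have hproj : proj N' (coarse L (natLift a)) = proj N' (natLift b) := by
    rw [proj_natLift]; exact h
  obtain ⟨k, hk⟩ := exists_period_of_proj_eq hproj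
  have heq : ∀ i, coarse L (natLift a) i = natLift b i := by
    intro i
    have hki : natLift b i = coarse L (natLift a) i + (N' : ℤ) * k i := by
      have := congrFun hk i; simpa [period] using this
    obtain ⟨hc0, hc1⟩ := hc i
    obtain ⟨hb0, hb1⟩ := hb i
    have hN' : (0 : ℤ) < N' := by exact_mod_cast hN
    have hk1 : k i < 1 := by
      by_contra hh
      have hh := not_lt.1 hh
      nlinarith
    have hk2 : -1 < k i := by
      by_contra hh
      have hh := not_lt.1 hh
      nlinarith
    have hk0 : k i = 0 := by omega
    rw [hki, hk0, mul_zero, add_zero]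
  rw [Fintype.mem_piFinset]
  intro i
  rw [Finset.mem_Ico]
  have hi : natLift a i / (L : ℤ) = natLift b i := by rw [← heq i]; rfl
  constructor
  · have := (Int.le_ediv_iff_mul_le hL').1 hi.symm.le
    linarith [mul_comm (natLift b i) (L : ℤ)]
  · have := (Int.ediv_lt_iff_lt_mul hL').1 (hi.le.trans_lt (lt_add_one _))
    linarith [mul_comm (natLift b i + 1) (L : ℤ)]

/-- **At most `L^d` cubes of the fine torus per block of the coarse torus.** [folklore] -/
theorem card_filter_tcoarse_le {L N' : ℕ} [NeZero L] [NeZero N'] (b : TPt d N') :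
    (Finset.univ.filter fun a : TPt d (L * N') => tcoarse L N' a = b).card ≤ L ^ d := by
  classical
  set B : Finset (Pt d) := Fintype.piFinset fun i => Finset.Ico ((L : ℤ) * natLift b i) ((L : ℤ) * natLift b i + L)
    with hB
  have hcard : B.card = L ^ d := by
    rw [hB, Fintype.card_piFinset]
    simp [Int.card_Ico]
  rw [← hcard]
  refine Finset.card_le_card_of_injOn natLift (fun a ha => ?_) (fun a _ a' _ h => ?_)
  · exact natLift_mem_box_of_tcoarse_eq (Finset.mem_filter.1 ha).2
  · have := congrArg (proj (L * N')) h
    simpa [proj_natLift] using this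

/-! ## §3 The anchor: every component with closure `Z′` meets the fine cubes under the 3^d-block of a chosen cell of `Z′` -/

/-- **ANCHOR, existence** (print p. 19–20 «the cubes touching a fixed LM-cube in Z′_i», KIND): if `Z′ = cl Z₀` is the
closure of the fine torus domain `Z₀` (pv22's `tclosureDom`) and `b ∈ Z′`, then some cube `a` of `Z₀` has `b` in the
coarse image of its block `□̃(a)` — i.e. `a` belongs to the anchor set of `b`. [folklore] -/
theorem exists_mem_anchor {L N' : ℕ} [NeZero L] [NeZero N'] (Z₀ : (tsys d (L * N')).Dom) {b : TPt d N'}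
    (hb : b ∈ (tclosureDom L N' Z₀).1) :
    ∃ a ∈ Z₀.1, ∃ y ∈ block (natLift a), proj N' (coarse L y) = b :=
  exists_lift_of_mem_tclosure (x := natLift) (fun a _ => proj_natLift a) hb

/-- **ANCHOR, size**: the cubes `a` of the fine torus admitting `y ∈ □̃(natLift a)` with `proj (coarse L y) = b` all
coarsen into `tblock b` (§1), so there are at most `3^d · L^d` of them (pv22's `card_tblock_le` and §2). [folklore] -/
theorem card_anchor_le {L N' : ℕ} [NeZero L] [NeZero N'] (b : TPt d N') :
    ((Finset.univ.filter fun a : TPt d (L * N') =>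
        ∃ y ∈ block (natLift a), proj N' (coarse L y) = b).card : ℝ) ≤ (3 : ℝ) ^ d * (L : ℝ) ^ d := by
  classical
  have hsub : (Finset.univ.filter fun a : TPt d (L * N') => ∃ y ∈ block (natLift a), proj N' (coarse L y) = b) ⊆
      (tblock b).biUnion fun b' => Finset.univ.filter fun a : TPt d (L * N') => tcoarse L N' a = b' := by
    intro a ha
    obtain ⟨y, hy, hyb⟩ := (Finset.mem_filter.1 ha).2
    exact Finset.mem_biUnion.2 ⟨tcoarse L N' a, tcoarse_mem_tblock hy hyb, Finset.mem_filter.2 ⟨Finset.mem_univ _, rfl⟩⟩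
  have h1 := Finset.card_le_card hsub
  have h2 : ((tblock b).biUnion fun b' => Finset.univ.filter fun a : TPt d (L * N') => tcoarse L N' a = b').card ≤
      3 ^ d * L ^ d :=
    calc _ ≤ ∑ b' ∈ tblock b, (Finset.univ.filter fun a : TPt d (L * N') => tcoarse L N' a = b').card :=
          Finset.card_biUnion_le
      _ ≤ ∑ _b' ∈ tblock b, L ^ d := Finset.sum_le_sum fun b' _ => card_filter_tcoarse_le b'
      _ = (tblock b).card * L ^ d := by rw [Finset.sum_const, smul_eq_mul]
      _ ≤ 3 ^ d * L ^ d := Nat.mul_le_mul_right _ (card_tblock_le b)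
  exact_mod_cast h1.trans h2


/-! ## §4 THE END ON THE NESTED TORI: N0w's `attachedPart_locE_le_of_coresAt_pencil_components` with `cl`∕`htransfer`∕`hanchor`∕`hA`
DISCHARGED — closure = pv22's `tclosureDom`, transfer = `ineq236With_torus`, anchor = §3 -/

section End

open Metric Set Complex MeasureTheory
open scoped BigOperators
open Literature.MathematicalPhysics.QuantumFieldTheory.Balaban1983to89.B13FamilySum (coveringFamilies)
open Literature.MathematicalPhysics.QuantumFieldTheory.Balaban1983to89.T4OutputRate (Carriers)
open Literature.MathematicalPhysics.QuantumFieldTheory.Balaban1983to89.B13Resummation (locE Geometry)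
open Literature.MathematicalPhysics.QuantumFieldTheory.Balaban1983to89.TreeLengthTorusGeometry (TTouch)
open Literature.MathematicalPhysics.QuantumFieldTheory.Balaban1983to89.B12TreeDecay (K₀)
open Literature.MathematicalPhysics.QuantumFieldTheory.Balaban1983to89.B13Geometry236 (a236)
open Summit.QuantumFields.BalabanUV.T4Continuum.B13HistMeasurable (MeasPotFrame B13HistM)
open Summit.QuantumFields.BalabanUV.T4Continuum.B13TermParamGaussianBi (BiCore)
open Summit.QuantumFields.BalabanUV.T4Continuum.NE1p.DressedSmallFieldComponentCount
  (attachedPart_locE_le_of_coresAt_pencil_components)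
open Summit.QuantumFields.BalabanUV.T4Continuum.NE1p.DressedSmallFieldGeometry (torus_consts)
open Summit.QuantumFields.BalabanUV.T4Continuum.NE1p.DressedSmallFieldGeometryFaces (K₀_four)

variable {L N' : ℕ} [NeZero L] [NeZero N']
variable {C : Carriers} {P : MeasPotFrame C} {Op : Type*} [NormedAddCommGroup Op] [NormedSpace ℂ Op] {ι₀ : Type}
  {𝒴 : ℕ → (Σ _ : Finset (TPt 4 N'), Σ F : Finset (tsys 4 N').Dom, ∀ Z ∈ F, (Σ _ : (tsys 4 (L * N')).Dom, ι₀)) → Type*}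
  {dom : ∀ k i, 𝒴 k i → C.Dom}
  {β : ℕ → (Σ _ : Finset (TPt 4 N'), Σ F : Finset (tsys 4 N').Dom, ∀ Z ∈ F, (Σ _ : (tsys 4 (L * N')).Dom, ι₀)) → Type*}
  [∀ k i, MeasurableSpace (β k i)]
  {α : ℕ → (Σ _ : Finset (TPt 4 N'), Σ F : Finset (tsys 4 N').Dom, ∀ Z ∈ F, (Σ _ : (tsys 4 (L * N')).Dom, ι₀)) → Type*}
  [∀ k i, NormedAddCommGroup (α k i)] [∀ k i, InnerProductSpace ℝ (α k i)] [∀ k i, FiniteDimensional ℝ (α k i)]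
  [∀ k i, MeasurableSpace (α k i)] [∀ k i, BorelSpace (α k i)]

open Classical in
/-- **N0w's END ON THE NESTED TORI OF THE PAPERS** (kernel; N0w's `attachedPart_locE_le_of_coresAt_pencil_components` ONCE BY NAME at
`D := tsys 4 N′`, `G := tgeometry 4 N′` (scale k+1: the torus blocked by `L`), `Dk := tsys 4 (L·N′)`, `Gk := tgeometry 4 (L·N′)`
(scale k: the SAME torus, `L·N′` cubes per direction), constants located at BOTH scales by N0o `torus_consts` + S24 `K₀_four`
(N′- and L-uniform numerals), and with THREE of N0w's displayed READING binders DISCHARGED: the closure `cl := tclosureDom L N′`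
(pv22 gen 3, print's Z ↦ Z′), the (2.36)-KIND transfer `htransfer` := pv22's `ineq236With_torus` at `ℓ := L ∕ a236 L` (`3 ≤ L`;
the cell's certified substitute of print's ½L, G-B13-09R), and the anchor `anc Z′ :=` the fine cubes whose `□̃` coarsens onto the
chosen cell `bsel Z′ ∈ Z′` (print p. 19–20 «the cubes touching a fixed LM-cube in Z′_i»), `hanchor` by §3 `exists_mem_anchor`,
`hA : #anc Z′ ≤ 3⁴·L⁴` by §3 `card_anchor_le`).  STILL DISPLAYED: the cell selector `bsel`∕`hbsel` (ANY choice of one cell per member,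
e.g. `Z′.2.1.choose`), N0u's inner-count SHAPE `hinner` (S41 PART 2 supplies it from N0u), N0v's (2.27)∘(2.37)-KIND
link `hlink` at the coarse torus, (B3-amp) `hAmp`, the (2.29)∕step clauses AS LOCATED NUMERALS (`64·log 162 + 1 ≤ r`,
`e·K₀(64,8)·64·a ≤ 1`, `r₁ + 2·(64·log 162) + 2 ≤ Rkp`, `(A₀+ϱA₁)·e^{5r₁+1}·K₀(64,8)·9·64 ≤ 1`), the rate bookkeeping
`hκR : 64·log 162 ≤ R₀`, `hrate2 : r + R ≤ (R₀ − 64·log 162)·(L ∕ a236 L)`, `hRR : Rkp ≤ R − 64·v·e^{Rc′}`; conclusion = the crew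
torus currency at the COARSE torus. [folklore] -/
theorem attachedPart_locE_le_of_coresAt_pencil_components_nestedTori (hL : 3 ≤ L) {Win : Set (ℕ → ℝ)}
    {ctr : ℕ → (ℕ → ℝ) → C.BgB → Op × B13HistM P} {ROp RHist R' : ℕ → ℝ}
    (𝔊 : ∀ k i, C.Dom → BiCore P (dom k i) Op (β k i) (α k i))
    {mq bq N₀ : ℕ → (Σ _ : Finset (TPt 4 N'), Σ F : Finset (tsys 4 N').Dom, ∀ Z ∈ F,
      (Σ _ : (tsys 4 (L * N')).Dom, ι₀)) → C.Dom → ℝ}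
    (hroom : ∀ k, ROp k < R' k)
    (hm : ∀ k, ∀ g ∈ Win, ∀ (U : C.BgB) (X : C.Dom), C.scale X = k → ∀ i, 0 < mq k i X)
    (hN : ∀ k, ∀ g ∈ Win, ∀ (U : C.BgB) (X : C.Dom), C.scale X = k → ∀ i,
      (∀ o ∈ ball (ctr k g U).1 (R' k), AEStronglyMeasurable ((𝔊 k i X).N o) (𝔊 k i X).lam) ∧
      (∀ p, DifferentiableOn ℂ (fun o => (𝔊 k i X).N o p) (ball (ctr k g U).1 (R' k))) ∧
      (∀ o ∈ ball (ctr k g U).1 (R' k), ∀ p, ‖(𝔊 k i X).N o p‖ ≤ N₀ k i X))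
    (hq : ∀ k, ∀ g ∈ Win, ∀ (U : C.BgB) (X : C.Dom), C.scale X = k → ∀ i,
      (∀ o ∈ ball (ctr k g U).1 (R' k),
        AEStronglyMeasurable (Function.uncurry ((𝔊 k i X).q o)) ((𝔊 k i X).lam.prod volume)) ∧
      (∀ p v, DifferentiableOn ℂ (fun o => (𝔊 k i X).q o p v) (ball (ctr k g U).1 (R' k))) ∧
      (∀ o ∈ ball (ctr k g U).1 (R' k), ∀ p v, mq k i X * ‖v‖ ^ 2 - bq k i X ≤ ((𝔊 k i X).q o p v).re))
    {k : ℕ} {g : ℕ → ℝ} (hg : g ∈ Win) {U : C.BgB} {o : Op} {h₀ w : B13HistM P} {ϱ : ℝ}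
    (hO : ‖o - (ctr k g U).1‖ ≤ ROp k) (hH : ‖h₀ - (ctr k g U).2‖ + ϱ * ‖w‖ ≤ RHist k)
    {emb : (tsys 4 N').Dom → C.Dom} (hscale : ∀ Z, C.scale (emb Z) = k)
    {terms : (tsys 4 N').Dom → Finset (Σ _ : Finset (TPt 4 N'), Σ F : Finset (tsys 4 N').Dom, ∀ Z ∈ F,
      (Σ _ : (tsys 4 (L * N')).Dom, ι₀))} {act : ℂ → (tsys 4 N').Dom → ℂ}
    (hact : ∀ σ ∈ ball (0 : ℂ) ϱ, ∀ Z, act σ Z = ∑ i ∈ terms Z, (𝔊 k i (emb Z)).termAt o (h₀ + σ • w))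
    {A₀ A₁ Rkp r₁ : ℝ} (X₀ : (tsys 4 N').Dom) (hA₀ : 0 ≤ A₀) (hA₁ : 0 ≤ A₁) (hr₁ : 0 ≤ r₁)
    (hrate : r₁ + 2 * (64 * Real.log 162) + 2 ≤ Rkp)
    (hsmall : (A₀ + ϱ * A₁) * Real.exp (5 * r₁ + 1) * K₀ 64 8 * 9 * 64 ≤ 1)
    -- the components' inner data (N0u's currency; `hinner` SHAPE displayed) and the cell selector of the anchor
    (I : (tsys 4 (L * N')).Dom → Finset ι₀) (m : (tsys 4 (L * N')).Dom → ι₀ → ℝ) (hm0 : ∀ Z₀ l, 0 ≤ m Z₀ l)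
    (bsel : (tsys 4 N').Dom → TPt 4 N') (hbsel : ∀ Z', bsel Z' ∈ Z'.1)
    {ε c₀ R₀ r R c' v : ℝ} (hε : 0 ≤ ε) (hv : 0 ≤ v)
    (hinner : ∀ Z₀ : (tsys 4 (L * N')).Dom, ∑ l ∈ I Z₀, m Z₀ l ≤ Real.exp c₀ * Real.exp (-(R₀ * torusTreeLen Z₀.1)))
    (hκR : 64 * Real.log 162 ≤ R₀) (hrate2 : r + R ≤ (R₀ - 64 * Real.log 162) * ((L : ℝ) / a236 L))
    (hκ : 64 * Real.log 162 + 1 ≤ r)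
    (h229 : Real.exp 1 * K₀ 64 8 * 64 *
      (ε * Real.exp c₀ * ((3 : ℝ) ^ 4 * (L : ℝ) ^ 4) * K₀ 64 8 * Real.exp (5 * R)) ≤ 1)
    (hlink : ∀ Z : (tsys 4 N').Dom, ∀ W ⊆ Z.1,
      ∀ F ∈ coveringFamilies Finset.univ (fun Y : (tsys 4 N').Dom => Y.1) (Z.1 \ W),
        torusTreeLen Z.1 - c' * W.card + 5 ≤ ∑ Z' ∈ F, (torusTreeLen Z'.1 + 5))
    (hRR : Rkp ≤ R - 64 * (v * Real.exp (R * c')))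
    (hadm : ∀ Z, ∀ l ∈ terms Z, l.1 ⊆ Z.1 ∧
      l.2.1 ∈ coveringFamilies Finset.univ (fun Y : (tsys 4 N').Dom => Y.1) (Z.1 \ l.1) ∧
      ∀ Z' (h : Z' ∈ l.2.1), l.2.2 Z' h ∈
        ((Finset.univ : Finset (tsys 4 (L * N')).Dom).filter (fun Z₀ => tclosureDom L N' Z₀ = Z')).sigma I)
    (hAmp : ∀ Z : (tsys 4 N').Dom, Z.1 ⊆ X₀.1 → ∀ l ∈ terms Z,
      (𝔊 k l (emb Z)).lam.real univ * ((𝔊 k l (emb Z)).wB * N₀ k l (emb Z) * Real.exp (bq k l (emb Z))) *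
          (Real.pi / (mq k l (emb Z) / 2)) ^ (Module.finrank ℝ (α k l) / 2 : ℝ) *
        Real.exp ((𝔊 k l (emb Z)).N₁ * (‖h₀‖ + ϱ * ‖w‖)) ≤
      (A₀ + ϱ * A₁) * (v ^ l.1.card * ∏ x ∈ l.2.1.attach, (ε * m (l.2.2 x.1 x.2).1 (l.2.2 x.1 x.2).2)))
    (hϱ : 2 ≤ ϱ) (hϱA : A₀ ≤ ϱ * A₁) :
    ‖locE (TTouch (d := 4) (N := N')) (fun Z : (tsys 4 N').Dom => Z.1) (act 1) X₀.1 -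
        locE (TTouch (d := 4) (N := N')) (fun Z : (tsys 4 N').Dom => Z.1) (act 0) X₀.1‖ ≤
      4 * (Real.exp 1 * 9 * 64 * K₀ 64 8 ^ 2) * A₁ * Real.exp (-(r₁ * torusTreeLen X₀.1)) := by
  obtain ⟨hν, hκ₀, hc⟩ := torus_consts N'
  obtain ⟨-, hκ₀k, -⟩ := torus_consts (L * N')
  have hK₀ := K₀_four (N := N')
  have hK₀k := K₀_four (N := L * N')
  have htr := ineq236With_torus (d := 4) L N' hL
  have h := attachedPart_locE_le_of_coresAt_pencil_components (tsys 4 N') (tgeometry 4 N') (tgeometry 4 (L * N')) 𝔊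
    hroom hm hN hq hg hO hH hscale hact (Rkp := Rkp) (b₅ := 5 * r₁) (X₀ := X₀) hA₀ hA₁ hr₁ (le_of_eq (by ring))
    (by rw [hκ₀]; exact hrate) (by rw [hK₀, hν, hc]; exact hsmall) I m hm0 (tclosureDom L N')
    (fun Z' => Finset.univ.filter fun a : TPt 4 (L * N') => ∃ y ∈ block (natLift a), proj N' (coarse L y) = bsel Z')
    (Aₐ := (3 : ℝ) ^ 4 * (L : ℝ) ^ 4) (ℓ := (L : ℝ) / a236 L) (c' := c') hε hv hinner
    (fun Z₀ Z' h => by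
      subst h
      obtain ⟨a, ha, y, hy, hyb⟩ := exists_mem_anchor Z₀ (hbsel (tclosureDom L N' Z₀))
      exact ⟨a, Finset.mem_filter.2 ⟨Finset.mem_univ _, y, hy, hyb⟩, ha⟩)
    (fun Z' => card_anchor_le (d := 4) (bsel Z'))
    (fun Z₀ Z' h => by subst h; exact htr Z₀) (by rw [hκ₀k]; exact hκR) (by rw [hκ₀k]; exact hrate2)
    (by rw [hκ₀]; exact hκ) (by rw [hK₀, hc, hK₀k]; exact h229) hlink (by rw [hc]; exact hRR) hadm hAmp hϱ hϱA
  rw [hν, hc, hK₀] at h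
  exact h

end End

end Summit.QuantumFields.BalabanUV.T4Continuum.NE1p.DressedSmallFieldNestedTori

end
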